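import Literature.Analysis.FluidPDE.PassiveVectorTensorPropagatorUnique
import HarnessLib

/-!
# K1L_D (stmt-AnomalousDissipation-27980), `stub_Z7_alphaBeta` α-provider: EULERIAN REPRESENTATION ON SUB-WINDOWS (the (E-repr) input of
# `FrameConj.isDistortedPropagator_conjProp`; helper; `--supports … --as helper`; lead-k1l-onelevel-p1 g5; memo L13)

`Torus.IsPropagator T₀ b 𝔸 U` represents (field `repr`) every weak solution on the FULL remaining window `(0, T₀ − s)`.  The frame conjugate of `U`
needs the same on SUB-windows `[t₁, t] ⊂ [0, T₀]`: every weak solution on `(0, t − t₁)` along `b (t₁ + ·)` from a divergence-free `L²` datum `φ`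
is `τ ↦ U t₁ (t₁ + τ) φ` a.e.  This file proves it from three generic facts:
* `IsWeakTensorPassiveVectorOn.of_le` — TIME SHORTENING: a weak solution on `[0,T)` is one on `[0,T')` for `T' ≤ T` (a `T'`-test is a `T`-test and
  the weak-form integrand vanishes on `[T', T)`);
* `memLp_top_stLift_comp_add_left'` — the carrier's essential bound passes to the shifted carrier (public copy of the private helper of
  `PassiveVectorTensorPropagator`);
* **`eulerian_subwindow_repr`** — Lions existence on the full window (`Torus.exists_windowSol`) + `IsPropagator.repr` + shortening + uniqueness
  (`IsWeakTensorPassiveVectorOn.ae_eq_of_memLp_top`).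
Generic dimension `d` where free; NOT a proof of any registered stub, of the crux, or of AD; rung F-D1.A0.
-/

set_option linter.dupNamespace false  -- the summit-side namespace `Summit.AnomalousDissipation.AnomalousDissipation.…` repeats a component by design (D-0017)

noncomputable section

namespace Summit.AnomalousDissipation.AnomalousDissipation.Theorems.SolenoidalFractalHomogenisation.LagrangianStep.FrameConj

open Literature.Analysis Literature.Analysis.FluidPDE Literature.Analysis.FluidPDE.Torus Literature.Analysis.FunctionSpaces
open MeasureTheory Set Filter Topology Function
open scoped InnerProductSpace ENNReal

variable {d : Type*} [Fintype d] [DecidableEq d]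

/-! ## §1 Time shortening of weak solutions -/

omit [Fintype d] [DecidableEq d] in
/-- The convective derivative of the zero field vanishes. -/
private theorem convect_zero_right' {F : Type*} [NormedAddCommGroup F] [NormedSpace ℝ F]
    (u : UnitAddTorus d → EuclideanSpace ℝ d) (x : UnitAddTorus d) :
    FunctionSpaces.Torus.convect u (0 : UnitAddTorus d → F) x = 0 := by
  unfold FunctionSpaces.Torus.convect FunctionSpaces.Torus.fderiv FunctionSpaces.Torus.liftAt
  simp

/-- **TIME SHORTENING.**  A weak tensor-viscosity passive-vector solution on `[0, T)` is one on `[0, T')` for every `T' ≤ T`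
(every `T'`-test is a `T`-test; on `[T', T)` the test vanishes identically, so the weak-form integrand is zero there).
[cite: DiPernaLions1989, §II.1 (12)–(14)] -/
theorem _root_.Literature.Analysis.FluidPDE.Torus.IsWeakTensorPassiveVectorOn.of_le {A T T' : ℝ} {𝔸 : Visc4 d}
    {b w : ℝ → UnitAddTorus d → EuclideanSpace ℝ d} {w₀ : UnitAddTorus d → EuclideanSpace ℝ d}
    (h : IsWeakTensorPassiveVectorOn A T 𝔸 b w₀ w) (hT' : T' ≤ T) : IsWeakTensorPassiveVectorOn A T' 𝔸 b w₀ w := by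
  have hsub : Ioo (0:ℝ) T' ⊆ Ioo 0 T := Ioo_subset_Ioo le_rfl hT'
  have hsubp : Ioo (0:ℝ) T' ×ˢ (univ : Set (EuclideanSpace ℝ d)) ⊆ Ioo 0 T ×ˢ univ := Set.prod_mono hsub le_rfl
  have hμ : volume.restrict (Ioo (0:ℝ) T' ×ˢ (univ : Set (EuclideanSpace ℝ d))) ≤ volume.restrict (Ioo 0 T ×ˢ univ) :=
    Measure.restrict_mono hsubp le_rfl
  have hν : volume.restrict (Ioo (0:ℝ) T') ≤ volume.restrict (Ioo 0 T) := Measure.restrict_mono hsub le_rfl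
  obtain ⟨C, hC⟩ := h.ae_lintegral_sq_le
  refine ⟨h.aestronglyMeasurable.mono_measure hμ, h.aestronglyMeasurable_carrier.mono_measure hμ,
    ⟨C, ae_restrict_of_ae_restrict_of_subset hsub hC⟩,
    lt_of_le_of_lt (lintegral_mono' hν le_rfl) h.lintegral_carrier_lt_top,
    lt_of_le_of_lt (lintegral_mono' hν le_rfl) h.lintegral_mul_lt_top,
    ae_restrict_of_ae_restrict_of_subset hsub h.ae_isWeaklyDivFree_carrier,
    ae_restrict_of_ae_restrict_of_subset hsub h.ae_isWeaklyDivFree, ?_⟩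
  intro Ψ hΨ hΨdiv
  obtain ⟨hsm, T'', hT'', hzero⟩ := hΨ
  have hΨT : FunctionSpaces.Torus.IsSpaceTimeTest T Ψ := ⟨hsm, T'', hT''.trans_le hT', hzero⟩
  have key := h.weak_eq Ψ hΨT hΨdiv
  -- the weak-form integrand vanishes for `t ≥ T'`
  set F : ℝ → ℝ := fun t => ∫ x, (⟪w t x, FunctionSpaces.Torus.timeDeriv Ψ t x +
      FunctionSpaces.Torus.convect (b t) (Ψ t) x + viscAdj 𝔸 (Ψ t) x⟫_ℝ + A * ⟪b t x, FunctionSpaces.Torus.convect (w t) (Ψ t) x⟫_ℝ) with hF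
  have hvan : ∀ t, T' ≤ t → F t = 0 := by
    intro t ht
    have hΨt : Ψ t = 0 := hzero t (hT''.le.trans ht)
    have hdt : ∀ x, FunctionSpaces.Torus.timeDeriv Ψ t x = 0 := by
      intro x
      unfold FunctionSpaces.Torus.timeDeriv
      have hev : (fun τ => Ψ τ x) =ᶠ[𝓝 t] fun _ => (0 : EuclideanSpace ℝ d) := by
        have hmem : Ioi T'' ∈ 𝓝 t := Ioi_mem_nhds (hT''.trans_le ht)
        filter_upwards [hmem] with τ hτ
        rw [hzero τ (le_of_lt hτ)]; rfl
      rw [hev.deriv_eq, deriv_const]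
    rw [hF]
    simp only [hdt, hΨt, convect_zero_right', viscAdj_zero_field, inner_zero_right, mul_zero, add_zero, integral_zero]
  -- hence the integral over `(0,T)` is the integral over `(0,T')`
  have hI : ∫ t in Ioo 0 T, F t = ∫ t in Ioo 0 T', F t := by
    have e1 : ∫ t in Ioo 0 T, F t = ∫ t in Ioo 0 T, (Ioo 0 T').indicator F t := by
      refine setIntegral_congr_fun measurableSet_Ioo fun t ht => ?_
      by_cases htT : t < T'
      · rw [Set.indicator_of_mem (show t ∈ Ioo 0 T' from ⟨ht.1, htT⟩) F]
      · rw [Set.indicator_of_notMem (show t ∉ Ioo 0 T' from fun h' => htT h'.2) F, hvan t (not_lt.1 htT)]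
    rw [e1, setIntegral_indicator measurableSet_Ioo, Set.inter_eq_right.2 hsub]
  rw [← hI]
  exact key

/-! ## §2 The shifted carrier keeps its essential bound -/

omit [DecidableEq d] in
/-- The essential bound of the carrier passes to the shifted carrier `τ ↦ b (s + τ)` on `(0, T − s) × T^d`.
-- adapted from the private `memLp_top_stLift_comp_add_left` of `Literature/Analysis/FluidPDE/PassiveVectorTensorPropagator.lean` -/
theorem memLp_top_stLift_comp_add_left' {T : ℝ} {b : ℝ → UnitAddTorus d → EuclideanSpace ℝ d}
    (hb : MemLp (FunctionSpaces.Torus.stLift b) ∞ (volume.restrict (Ioo 0 T ×ˢ univ))) {s : ℝ} (hs : 0 ≤ s) :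
    MemLp (FunctionSpaces.Torus.stLift (fun τ => b (s + τ))) ∞ (volume.restrict (Ioo 0 (T - s) ×ˢ univ)) := by
  set θ : ℝ × EuclideanSpace ℝ d → ℝ × EuclideanSpace ℝ d := fun p => (s + p.1, p.2) with hθ
  have hθmp : MeasurePreserving θ (volume : Measure (ℝ × EuclideanSpace ℝ d)) volume := by
    have h := (measurePreserving_add_left (volume : Measure ℝ) s).prod
      (MeasurePreserving.id (volume : Measure (EuclideanSpace ℝ d)))
    have e : Prod.map (fun t : ℝ => s + t) id = θ := by
      funext p; rfl
    rw [e] at h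
    exact h
  have hpre : θ ⁻¹' (Ioo s T ×ˢ univ) = Ioo 0 (T - s) ×ˢ univ := by
    ext p
    simp only [hθ, mem_preimage, mem_prod, mem_univ, and_true, mem_Ioo]
    constructor <;> rintro ⟨h1, h2⟩ <;> constructor <;> linarith
  have hθr : MeasurePreserving θ (volume.restrict (Ioo 0 (T - s) ×ˢ univ)) (volume.restrict (Ioo s T ×ˢ univ)) := by
    have h := hθmp.restrict_preimage (measurableSet_Ioo.prod MeasurableSet.univ) (s := Ioo s T ×ˢ univ)
    rwa [hpre] at h
  have hb₀ : MemLp (FunctionSpaces.Torus.stLift b) ∞ (volume.restrict (Ioo s T ×ˢ univ)) :=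
    hb.mono_measure (Measure.restrict_mono (Set.prod_mono (Ioo_subset_Ioo hs le_rfl) le_rfl) le_rfl)
  have hcomp : MemLp (FunctionSpaces.Torus.stLift b ∘ θ) ∞ (volume.restrict (Ioo 0 (T - s) ×ˢ univ)) :=
    hb₀.comp_measurePreserving hθr
  have e : FunctionSpaces.Torus.stLift (fun τ => b (s + τ)) = FunctionSpaces.Torus.stLift b ∘ θ := by
    funext p
    simp only [FunctionSpaces.Torus.stLift, hθ, Function.comp_apply]
  rw [e]
  exact hcomp

/-! ## §3 Representation on sub-windows -/

/-- **EULERIAN REPRESENTATION ON SUB-WINDOWS.**  For a propagator `U` on `[0, T₀]` of the constant-tensor class (elliptic `𝔸`, bounded a.e.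
divergence-free carrier), every weak solution on a sub-window `[t₁, t] ⊂ [0, T₀]` from a divergence-free `L²` datum is `τ ↦ U t₁ (t₁ + τ) φ` a.e.
[cite: Pazy1983, Ch. 5 §5.1 Thm. 5.3] [cite: LionsMagenes1972, Chap. 3 Thm. 1.1] -/
theorem eulerian_subwindow_repr {T₀ : ℝ} {b : ℝ → UnitAddTorus d → EuclideanSpace ℝ d} {𝔸 : Visc4 d}
    {U : ℝ → ℝ → (Lp (EuclideanSpace ℝ d) 2 (volume : Measure (UnitAddTorus d)) →L[ℝ] Lp (EuclideanSpace ℝ d) 2 (volume : Measure (UnitAddTorus d)))}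
    (hU : IsPropagator T₀ b 𝔸 U) {lo hi : ℝ} (h𝔸 : NearIso 𝔸 lo hi) (hlo : 0 < lo)
    (hb : MemLp (FunctionSpaces.Torus.stLift b) ∞ (volume.restrict (Ioo 0 T₀ ×ˢ univ)))
    (hbdiv : ∀ᵐ t ∂(volume.restrict (Ioo 0 T₀)), FunctionSpaces.Torus.IsWeaklyDivFree (b t))
    {t₁ t : ℝ} (ht₁ : 0 ≤ t₁) (ht₁t : t₁ < t) (ht : t ≤ T₀)
    {φ : UnitAddTorus d → EuclideanSpace ℝ d} (hφ : MemLp φ 2 volume) (hφdiv : FunctionSpaces.Torus.IsWeaklyDivFree φ)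
    {u : ℝ → UnitAddTorus d → EuclideanSpace ℝ d}
    (hu : IsWeakTensorPassiveVectorOn 0 (t - t₁) 𝔸 (fun τ => b (t₁ + τ)) φ u) :
    ∀ᵐ τ ∂(volume.restrict (Ioo 0 (t - t₁))), ∃ hτ : MemLp (u τ) 2 volume, hτ.toLp (u τ) = U t₁ (t₁ + τ) (hφ.toLp φ) := by
  have ht₁T : t₁ < T₀ := ht₁t.trans_le ht
  -- Lions solution on the full remaining window, represented by `U`
  obtain ⟨W, hW⟩ := exists_windowSol h𝔸 hlo hb hbdiv ht₁ ht₁T hφ hφdiv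
  have hrep := hU.repr t₁ ht₁ ht₁T φ hφ hφdiv W hW
  -- shorten it to the sub-window and compare with `u` by uniqueness
  have hW' := hW.of_le (show t - t₁ ≤ T₀ - t₁ by linarith)
  have hb' : MemLp (FunctionSpaces.Torus.stLift (fun τ => b (t₁ + τ))) ∞ (volume.restrict (Ioo 0 (t - t₁) ×ˢ univ)) :=
    (memLp_top_stLift_comp_add_left' hb ht₁).mono_measure
      (Measure.restrict_mono (Set.prod_mono (Ioo_subset_Ioo le_rfl (by linarith)) le_rfl) le_rfl)
  have huniq := IsWeakTensorPassiveVectorOn.ae_eq_of_memLp_top h𝔸 hlo hu hW' hb'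
  have hrep' : ∀ᵐ τ ∂(volume.restrict (Ioo 0 (t - t₁))), ∃ hτ : MemLp (W τ) 2 volume, hτ.toLp (W τ) = U t₁ (t₁ + τ) (hφ.toLp φ) :=
    ae_restrict_of_ae_restrict_of_subset (Ioo_subset_Ioo le_rfl (by linarith)) hrep
  filter_upwards [huniq, hrep'] with τ h1 h2
  obtain ⟨hm, he⟩ := h2
  refine ⟨hm.ae_eq h1.symm, ?_⟩
  rw [← he]
  exact Lp.ext ((MemLp.coeFn_toLp _).trans (h1.trans (MemLp.coeFn_toLp hm).symm))

end Summit.AnomalousDissipation.AnomalousDissipation.Theorems.SolenoidalFractalHomogenisation.LagrangianStep.FrameConj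

end
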